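import Mathlib
import HarnessLib
import Summits.NavierStokesRegularity.NavierStokesRegularity.Theorems.UnthreadedDoorAntidynamoWallCaloricFarPast
import Summits.NavierStokesRegularity.NavierStokesRegularity.Theorems.UnthreadedDoorAntidynamoWallOneInstantRigidMotion

/-!
# Route `UnthreadedDoor` / `ThreadingFlux`, crux `PoloidalLiouville` (stmt-NavierStokesRegularity-1222), antidynamo v2 skeleton (sha16 `4ebf5683127b`),
# WALL `stub_scalarLiouville`: ANTI-symmetric vorticity under a rigid motion at ACCUMULATING TIMES (any centre / fixed-point-free) ⇒ irrotational

Support file (seat leafhand-ns-unthreadeddoor-2 g2, cell decomp-ns), `--supports stmt-NavierStokesRegularity-1222 --as helper`; theorems only.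

The landed anti-twin closer (`curl_eq_zero_of_curl_antisymmetric_farPast`, p817183: vorticity ANTI-symmetric as a pseudovector about `x₀` under a linear
isometry `R` on a FAR PAST ⇒ irrotational, mechanism C: drift-caloric vorticity) is upgraded in two directions:

* ★★ `curl_eq_zero_of_curl_antisymmetric_frequently` — anti-symmetry about `x₀` at a set of times ACCUMULATING at some `t₀ < 0` suffices: in the analytic frame
  of `CellFlux.unthreadedAnalyticOrIrrotational` each `t ↦ curl v(t)(x₀ + R y) + det R • R (curl v(t)(x₀ + y))` is real-analytic on `(−∞,0)` and vanishes
  frequently near `t₀`, hence identically (identity theorem), and the far-past closer applies with `t₁ = 0`.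
* ★★ `curl_eq_zero_of_curl_antisymmetric_rigidMotion_frequently` — anti-symmetry under a GENERAL rigid motion `y ↦ R y + b` (any centre; screws, glides,
  «anti-periodic» translations) at accumulating times ⇒ irrotational: if `R x₀ + b ≠ x₀` it is a SECOND CENTRE of tangency at one instant
  (`curl_eq_zero_of_two_centres_slice`, one-instant Z), otherwise the motion is `y ↦ x₀ + R(y − x₀)` and the first theorem applies.

HONEST LABEL: identity theorem + landed closers; nothing here proves `stub_scalarLiouville`, `PoloidalLiouville` (1222), or bears on Navier–Stokes regularity;
no summit statement is proved. [folklore] [cite: KochNadirashviliSereginSverak2009, Thm 5.2 (arXiv:0709.3599 pp. 9–10); LemarieRieusset2016, Thm. 9.12]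
-/

noncomputable section

-- the summit and its single sub-problem share the name (CONVENTIONS §1)
set_option linter.dupNamespace false

open scoped Topology InnerProductSpace RealInnerProductSpace ContDiff
open Filter Set Function Metric MeasureTheory
open Literature.Analysis Literature.Analysis.FluidPDE

namespace Summit.NavierStokesRegularity.NavierStokesRegularity.Theorems.PoloidalLiouville.Antidynamo

open Summit.NavierStokesRegularity.NavierStokesRegularity.Theorems.PoloidalLiouville
  (toroidalPotential exists_norm_curl_le constantOfIrrotational)
open Summit.NavierStokesRegularity.NavierStokesRegularity.Theorems.PoloidalLiouville.NetFlux (E3)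

namespace OneInstant

/-! ### ★★ Anti-symmetric about `x₀` at accumulating times -/

/-- ★★ **VORTICITY ANTI-SYMMETRIC ABOUT `x₀` AT ACCUMULATING TIMES ⇒ IRROTATIONAL.**  Let `v` be a bounded ancient mild solution (`ν = 1`, duality class) with
measurable slices, jointly smooth on `(−∞,0) × ℝ³`, with vorticity tangent to the spheres about `x₀`.  If for some `t₀ < 0` the anti-symmetry
`curl v(t)(x₀ + R y) = −det R • R (curl v(t)(x₀ + y))` (all `y`) holds at times `t` accumulating at `t₀`, then `curl v ≡ 0` on `(−∞,0) × ℝ³`.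
[cite: KochNadirashviliSereginSverak2009, Thm 5.2 (arXiv:0709.3599 pp. 9–10); LemarieRieusset2016, Thm. 9.12] -/
theorem curl_eq_zero_of_curl_antisymmetric_frequently
    (v : ℝ → EuclideanSpace ℝ (Fin 3) → EuclideanSpace ℝ (Fin 3)) (x₀ : EuclideanSpace ℝ (Fin 3))
    (hB : Literature.Analysis.FluidPDE.IsBoundedAncientMildSolution 1 v)
    (hm : ∀ t < 0, AEStronglyMeasurable (v t) volume)
    (hsm : ContDiffOn ℝ (⊤ : ℕ∞) (Function.uncurry v) (Set.Iio 0 ×ˢ Set.univ))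
    (hun : ∀ t < 0, ∀ x, ⟪x - x₀, curl (v t) x⟫ = 0)
    (R : EuclideanSpace ℝ (Fin 3) ≃ₗᵢ[ℝ] EuclideanSpace ℝ (Fin 3))
    (hfr : ∃ t₀ < 0, ∃ᶠ t in 𝓝[≠] t₀, ∀ y, curl (v t) (x₀ + R y) =
      -((R : EuclideanSpace ℝ (Fin 3) →L[ℝ] EuclideanSpace ℝ (Fin 3)).det • R (curl (v t) (x₀ + y)))) :
    ∀ t < 0, ∀ x, curl (v t) x = 0 := by
  obtain ⟨t₀, ht₀, hfr⟩ := hfr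
  obtain ⟨K, hK⟩ := exists_norm_curl_le hB hsm
  obtain ⟨T, -, -, hlink⟩ := toroidalPotential v x₀ K hsm hK hun
  rcases CellFlux.unthreadedAnalyticOrIrrotational v x₀ T hB hm hsm hlink with hA | hZ
  · -- analytic continuation in time of the anti-symmetry identity
    have hω := CellFlux.analyticOnNhd_curl_uncurry hA
    have hωt : ∀ z : EuclideanSpace ℝ (Fin 3), AnalyticOnNhd ℝ (fun t => curl (v t) z) (Iio 0) := fun z t ht =>
      (hω (t, z) ⟨ht, mem_univ _⟩).comp₂ analyticAt_id analyticAt_const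
    have hanti : ∀ t < 0, ∀ y, curl (v t) (x₀ + R y) =
        -((R : EuclideanSpace ℝ (Fin 3) →L[ℝ] EuclideanSpace ℝ (Fin 3)).det • R (curl (v t) (x₀ + y))) := by
      intro t ht y
      set g : ℝ → EuclideanSpace ℝ (Fin 3) := fun s => curl (v s) (x₀ + R y) +
        (R : EuclideanSpace ℝ (Fin 3) →L[ℝ] EuclideanSpace ℝ (Fin 3)).det • R (curl (v s) (x₀ + y)) with hg
      have hga : AnalyticOnNhd ℝ g (Iio 0) := by
        intro s hs
        have h1 := hωt (x₀ + R y) s hs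
        have h2 := hωt (x₀ + y) s hs
        have hRa : ∀ z : EuclideanSpace ℝ (Fin 3), AnalyticAt ℝ (⇑R) z := fun z => R.analyticAt z
        simp only [hg]
        fun_prop
      have hgfr : ∃ᶠ s in 𝓝[≠] t₀, g s = 0 := hfr.mono fun s hs => by
        simp only [hg, hs y, neg_add_cancel]
      have h0 := hga.eqOn_zero_of_preconnected_of_frequently_eq_zero isPreconnected_Iio ht₀ hgfr ht
      simp only [hg, Pi.zero_apply] at h0
      exact eq_neg_of_add_eq_zero_left h0
    exact curl_eq_zero_of_curl_antisymmetric_farPast v x₀ hB hm hsm hun R (le_refl (0 : ℝ)) fun t ht y => hanti t ht y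
  · exact hZ

/-! ### ★★ Anti-symmetric under a general rigid motion at accumulating times -/

/-- ★★ **VORTICITY ANTI-SYMMETRIC UNDER A RIGID MOTION `y ↦ R y + b` AT ACCUMULATING TIMES ⇒ IRROTATIONAL** (any centre; fixed-point-free motions included).
`R x₀ + b` is a second centre of tangency at each such time; if it differs from `x₀` the flow is irrotational by the one-instant two-centres closer,
otherwise the anti-symmetry is about `x₀` and the previous theorem applies. [cite: KochNadirashviliSereginSverak2009, Thm 5.2 (arXiv:0709.3599 pp. 9–10); LemarieRieusset2016, Thm. 9.12] -/
theorem curl_eq_zero_of_curl_antisymmetric_rigidMotion_frequently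
    (v : ℝ → EuclideanSpace ℝ (Fin 3) → EuclideanSpace ℝ (Fin 3)) (x₀ : EuclideanSpace ℝ (Fin 3))
    (hB : Literature.Analysis.FluidPDE.IsBoundedAncientMildSolution 1 v)
    (hm : ∀ t < 0, AEStronglyMeasurable (v t) volume)
    (hsm : ContDiffOn ℝ (⊤ : ℕ∞) (Function.uncurry v) (Set.Iio 0 ×ˢ Set.univ))
    (hun : ∀ t < 0, ∀ x, ⟪x - x₀, curl (v t) x⟫ = 0)
    (R : EuclideanSpace ℝ (Fin 3) ≃ₗᵢ[ℝ] EuclideanSpace ℝ (Fin 3)) (b : EuclideanSpace ℝ (Fin 3))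
    (hfr : ∃ t₀ < 0, ∃ᶠ t in 𝓝[≠] t₀, ∀ y, curl (v t) (R y + b) =
      -((R : EuclideanSpace ℝ (Fin 3) →L[ℝ] EuclideanSpace ℝ (Fin 3)).det • R (curl (v t) y))) :
    ∀ t < 0, ∀ x, curl (v t) x = 0 := by
  obtain ⟨t₀, ht₀, hfr⟩ := hfr
  by_cases hfix : R x₀ + b = x₀
  · -- the motion is `y ↦ x₀ + R (y − x₀)`: anti-symmetry about `x₀`
    refine curl_eq_zero_of_curl_antisymmetric_frequently v x₀ hB hm hsm hun R ⟨t₀, ht₀, hfr.mono fun t ht y => ?_⟩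
    have h := ht (x₀ + y)
    have e1 : R (x₀ + y) + b = x₀ + R y := by rw [map_add, add_right_comm, hfix]
    rwa [e1] at h
  · -- the motion moves `x₀`: a second centre at one (negative) instant
    have hfr' : ∃ᶠ t in 𝓝[≠] t₀, t < 0 ∧ ∀ y, curl (v t) (R y + b) =
        -((R : EuclideanSpace ℝ (Fin 3) →L[ℝ] EuclideanSpace ℝ (Fin 3)).det • R (curl (v t) y)) :=
      (hfr.and_eventually (mem_nhdsWithin_of_mem_nhds (Iio_mem_nhds ht₀))).mono fun t ht => ⟨ht.2, ht.1⟩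
    obtain ⟨t₁, ht₁, hanti⟩ := hfr'.exists
    refine curl_eq_zero_of_two_centres_slice v x₀ hB hm hsm hun ⟨t₁, ht₁, R x₀ + b, hfix, fun z => ?_⟩
    set y : EuclideanSpace ℝ (Fin 3) := R.symm (z - b) with hy
    have hz : z = R y + b := by rw [hy, LinearIsometryEquiv.apply_symm_apply, sub_add_cancel]
    rw [hz, hanti, inner_neg_right, inner_smul_right]
    have e2 : R y + b - (R x₀ + b) = R (y - x₀) := by rw [map_sub]; abel
    rw [e2, LinearIsometryEquiv.inner_map_map, hun t₁ ht₁, mul_zero, neg_zero]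

/-- ★★ **… HENCE SLICE-WISE CONSTANT.** [cite: KochNadirashviliSereginSverak2009, Thm 5.2 (arXiv:0709.3599 pp. 9–10)] -/
theorem constant_of_curl_antisymmetric_rigidMotion_frequently
    (v : ℝ → EuclideanSpace ℝ (Fin 3) → EuclideanSpace ℝ (Fin 3)) (x₀ : EuclideanSpace ℝ (Fin 3))
    (hB : Literature.Analysis.FluidPDE.IsBoundedAncientMildSolution 1 v)
    (hm : ∀ t < 0, AEStronglyMeasurable (v t) volume)
    (hsm : ContDiffOn ℝ (⊤ : ℕ∞) (Function.uncurry v) (Set.Iio 0 ×ˢ Set.univ))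
    (hun : ∀ t < 0, ∀ x, ⟪x - x₀, curl (v t) x⟫ = 0)
    (R : EuclideanSpace ℝ (Fin 3) ≃ₗᵢ[ℝ] EuclideanSpace ℝ (Fin 3)) (b : EuclideanSpace ℝ (Fin 3))
    (hfr : ∃ t₀ < 0, ∃ᶠ t in 𝓝[≠] t₀, ∀ y, curl (v t) (R y + b) =
      -((R : EuclideanSpace ℝ (Fin 3) →L[ℝ] EuclideanSpace ℝ (Fin 3)).det • R (curl (v t) y))) :
    ∀ t < 0, ∃ c : EuclideanSpace ℝ (Fin 3), ∀ x, v t x = c :=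
  constantOfIrrotational v hB hsm (curl_eq_zero_of_curl_antisymmetric_rigidMotion_frequently v x₀ hB hm hsm hun R b hfr)

end OneInstant

end Summit.NavierStokesRegularity.NavierStokesRegularity.Theorems.PoloidalLiouville.Antidynamo

end
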